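import Literature.Computability.Complexity.Sensitivity
import HarnessLib

/-!
# `√s(f) ≤ λ(f)`: the star witness (Aaronson–Ben-David–Kothari–Rao–Tal, Lemma 32)

ABKRT, STOC 2021, §8.4 **Lemma 32**: «For all (possibly partial) functions `f`, `s(f) ≤ λ(f)²`.
Proof. Consider any input `x` with sensitivity `s(f)`. This means `x` has `s(f)` neighbors on the
hypercube with different `f` value. The sensitivity graph restricted to these `s(f)+1` inputs is a
star graph centered at `x`. The spectral norm of the adjacency matrix of the star graph on `k+1`
vertices is `√k`. Since the spectral norm of `A_f` is lower bounded by that of a submatrix, we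
have `λ(f) ≥ √(s(f))`.» Followed by: «This relationship is tight for the `OR_n` function which has
`s(OR_n) = n` and `λ(OR_n) = √n`.»

In the tree's Rayleigh-quotient vocabulary (`Sensitivity.lean`, `HuangDegree.lean`,
`QuantumComplexity/SpectralAdversary.lean`: `λ(f)` only through the sums
`∑_x ∑_{i : f(x) ≠ f(x^i)} δ_x δ_{x^i}` on unit vectors `δ ≥ 0`) the star graph becomes an explicit
witness vector: for every `f` and every input `x` there is a unit `δ ≥ 0` — weight `1/√2` on `x`,
`1/√(2 s_x)` on each sensitive neighbour `x^i` — with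
`√(s_x(f)) ≤ ∑_y ∑_{i : f(y) ≠ f(y^i)} δ_y δ_{y^i}` (`exists_unit_sqrt_sensitivityAt_le_lambdaSum`),
hence one with `√(s(f)) ≤ …` (`exists_unit_sqrt_sensitivity_le_lambdaSum`). Together with
`lambdaSum_le_sqrt_mul_sum_sq` / `lambdaSum_le_sensitivity_mul_sum_sq` of `Sensitivity.lean` this
is the printed sandwich `√s(f) ≤ λ(f) ≤ √(s₀(f) s₁(f)) ≤ s(f)`, tight at `OR_n`. No named facts.

## References

* S. Aaronson, S. Ben-David, R. Kothari, S. Rao, A. Tal, *Degree vs. approximate degree and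
  quantum implications of Huang's sensitivity theorem*, STOC 2021 (arXiv:2010.12629), §8.4
  Lemma 32 and the remark after it [AaronsonBenDavidKothariRaoTal2021].
-/

noncomputable section

namespace Literature.Computability.Complexity

open Finset

variable {N : ℕ}

/-- Distinct positions give distinct neighbours: `i ↦ x^i` is injective. [folklore] -/
private theorem flipBlock_singleton_injective (x : Fin N → Bool) :
    Function.Injective fun i : Fin N => flipBlock x {i} := by
  intro i j h
  by_contra hij
  have e := congrFun h i
  simp only [flipBlock_singleton_apply_self, flipBlock_singleton_apply_of_ne x hij] at e
  cases hx : x i <;> simp [hx] at e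

/-- A neighbour is not the centre: `x^i ≠ x`. [folklore] -/
private theorem flipBlock_singleton_ne (x : Fin N → Bool) (i : Fin N) : flipBlock x {i} ≠ x := by
  intro h
  have e := congrFun h i
  simp only [flipBlock_singleton_apply_self] at e
  cases hx : x i <;> simp [hx] at e

/-- **The star witness at an input** (ABKRT Lemma 32, Rayleigh form): for every `f` and `x` there
is a unit vector `δ ≥ 0` on the cube with
`√(s_x(f)) ≤ ∑_y ∑_{i : f(y) ≠ f(y^i)} δ_y δ_{y^i}` («the sensitivity graph restricted to these
`s+1` inputs is a star graph centered at `x` … spectral norm `√k`»): `δ_x = 1/√2`,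
`δ_{x^i} = 1/√(2 s_x)` on the sensitive neighbours, `0` elsewhere.
[cite: AaronsonBenDavidKothariRaoTal2021, Lemma 32] -/
theorem exists_unit_sqrt_sensitivityAt_le_lambdaSum (f : (Fin N → Bool) → Bool)
    (x : Fin N → Bool) :
    ∃ δ : (Fin N → Bool) → ℝ, (∀ y, 0 ≤ δ y) ∧ ∑ y, δ y ^ 2 = 1 ∧
      Real.sqrt (sensitivityAt f x) ≤
        ∑ y, ∑ i, (if f y = f (flipBlock y {i}) then (0 : ℝ) else δ y * δ (flipBlock y {i})) := by
  classical
  -- nonnegativity of the `λ`-sum for any `δ ≥ 0`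
  have hnn : ∀ δ : (Fin N → Bool) → ℝ, (∀ y, 0 ≤ δ y) →
      ∀ y i, 0 ≤ (if f y = f (flipBlock y {i}) then (0 : ℝ) else δ y * δ (flipBlock y {i})) :=
    fun δ hδ y i => by
      split_ifs
      · exact le_rfl
      · exact mul_nonneg (hδ _) (hδ _)
  set S := Finset.univ.filter fun i => f (flipBlock x {i}) ≠ f x with hS
  have hScard : (S.card : ℝ) = sensitivityAt f x := by rw [sensitivityAt_eq_card]
  rcases Nat.eq_zero_or_pos S.card with h0 | hpos
  · -- no sensitive neighbour: the indicator of `x` will do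
    set δ₀ : (Fin N → Bool) → ℝ := fun y => if y = x then 1 else 0 with hδ₀
    have hδ₀0 : ∀ y, 0 ≤ δ₀ y := fun y => by
      simp only [hδ₀]
      split_ifs <;> norm_num
    refine ⟨δ₀, hδ₀0, ?_, ?_⟩
    · simp [hδ₀, Finset.sum_ite_eq']
    · rw [← hScard, h0, Nat.cast_zero, Real.sqrt_zero]
      exact Finset.sum_nonneg fun y _ => Finset.sum_nonneg fun i _ => hnn δ₀ hδ₀0 y i
  · -- the star on `x` and its `s = |S|` sensitive neighbours
    set s : ℝ := (S.card : ℝ) with hs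
    have hs0 : 0 < s := by rw [hs]; exact_mod_cast hpos
    set a : ℝ := Real.sqrt (1 / 2) with ha
    set b : ℝ := Real.sqrt (1 / (2 * s)) with hb
    have ha0 : 0 ≤ a := Real.sqrt_nonneg _
    have hb0 : 0 ≤ b := Real.sqrt_nonneg _
    have ha2 : a ^ 2 = 1 / 2 := Real.sq_sqrt (by norm_num)
    have hb2 : b ^ 2 = 1 / (2 * s) := Real.sq_sqrt (by positivity)
    have hab : a * b = 1 / (2 * Real.sqrt s) := by
      rw [ha, hb, ← Real.sqrt_mul (by norm_num : (0 : ℝ) ≤ 1 / 2)]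
      have e : (1 / 2 : ℝ) * (1 / (2 * s)) = 1 / (4 * s) := by ring
      rw [e, Real.sqrt_div zero_le_one, Real.sqrt_one,
        Real.sqrt_mul (by norm_num : (0 : ℝ) ≤ 4)]
      have h4 : Real.sqrt 4 = 2 := by
        rw [show (4 : ℝ) = 2 ^ 2 by norm_num, Real.sqrt_sq (by norm_num : (0 : ℝ) ≤ 2)]
      rw [h4]
    set star : Finset (Fin N → Bool) := S.image fun i => flipBlock x {i} with hstar
    have hxstar : x ∉ star := by
      intro hx
      obtain ⟨i, -, hi⟩ := Finset.mem_image.1 hx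
      exact flipBlock_singleton_ne x i hi
    have hstarcard : (star.card : ℝ) = s := by
      rw [hstar, Finset.card_image_of_injective _ (flipBlock_singleton_injective x)]
    set δ : (Fin N → Bool) → ℝ := fun y => if y = x then a else if y ∈ star then b else 0 with hδ
    have hδ0 : ∀ y, 0 ≤ δ y := fun y => by
      simp only [hδ]
      split_ifs
      · exact ha0
      · exact hb0
      · exact le_rfl
    have hδx : δ x = a := by simp [hδ]
    have hδnb : ∀ i ∈ S, δ (flipBlock x {i}) = b := by
      intro i hi
      have h1 : flipBlock x {i} ≠ x := flipBlock_singleton_ne x i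
      have h2 : flipBlock x {i} ∈ star := Finset.mem_image.2 ⟨i, hi, rfl⟩
      simp [hδ, h1, h2]
    refine ⟨δ, hδ0, ?_, ?_⟩
    · -- `∑ δ² = a² + |star| b² = 1/2 + s/(2s) = 1`
      have hsq : ∀ y, δ y ^ 2 = (if y = x then a ^ 2 else 0) + (if y ∈ star then b ^ 2 else 0) := by
        intro y
        simp only [hδ]
        by_cases hyx : y = x
        · subst hyx
          simp [hxstar]
        · by_cases hys : y ∈ star
          · simp [hyx, hys]
          · simp [hyx, hys]
      simp_rw [hsq]
      rw [Finset.sum_add_distrib, Finset.sum_ite_eq' Finset.univ x, if_pos (Finset.mem_univ x),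
        Finset.sum_ite_mem, Finset.univ_inter, Finset.sum_const, nsmul_eq_mul, hstarcard, ha2, hb2]
      field_simp
      norm_num
    · -- the `2 s` star edges `(x, x^i)` and `(x^i, x)`, `i ∈ S`, each contribute `a b`
      set t : (Fin N → Bool) × Fin N → ℝ := fun p =>
        if f p.1 = f (flipBlock p.1 {p.2}) then (0 : ℝ) else δ p.1 * δ (flipBlock p.1 {p.2}) with ht
      have ht0 : ∀ p, 0 ≤ t p := fun p => hnn δ hδ0 p.1 p.2
      -- the two families of star edges, as disjoint sub-families of all pairs `(y, i)`
      set E₁ : Finset ((Fin N → Bool) × Fin N) := S.image fun i => (x, i) with hE₁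
      set E₂ : Finset ((Fin N → Bool) × Fin N) := S.image fun i => (flipBlock x {i}, i) with hE₂
      have hinj₁ : Function.Injective fun i : Fin N => ((x, i) : (Fin N → Bool) × Fin N) :=
        fun i j h => (Prod.ext_iff.1 h).2
      have hinj₂ : Function.Injective
          fun i : Fin N => ((flipBlock x {i}, i) : (Fin N → Bool) × Fin N) :=
        fun i j h => (Prod.ext_iff.1 h).2
      have hdisj : Disjoint E₁ E₂ := by
        rw [Finset.disjoint_left]
        intro p hp1 hp2
        obtain ⟨i, -, rfl⟩ := Finset.mem_image.1 hp1
        obtain ⟨j, -, hj⟩ := Finset.mem_image.1 hp2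
        exact flipBlock_singleton_ne x j (Prod.ext_iff.1 hj).1
      have hE₁sum : ∑ p ∈ E₁, t p = s * (a * b) := by
        rw [hE₁, Finset.sum_image fun i _ j _ h => hinj₁ h]
        have e : ∀ i ∈ S, t (x, i) = a * b := by
          intro i hi
          have hsi : f x ≠ f (flipBlock x {i}) := fun h => (Finset.mem_filter.1 hi).2 h.symm
          simp only [ht, if_neg hsi, hδx, hδnb i hi]
        rw [Finset.sum_congr rfl e, Finset.sum_const, nsmul_eq_mul]
      have hE₂sum : ∑ p ∈ E₂, t p = s * (a * b) := by
        rw [hE₂, Finset.sum_image fun i _ j _ h => hinj₂ h]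
        have e : ∀ i ∈ S, t (flipBlock x {i}, i) = a * b := by
          intro i hi
          have hsi : f (flipBlock x {i}) ≠ f (flipBlock (flipBlock x {i}) {i}) := by
            rw [flipBlock_singleton_flipBlock_singleton]
            exact (Finset.mem_filter.1 hi).2
          simp only [ht, if_neg hsi]
          rw [flipBlock_singleton_flipBlock_singleton, hδnb i hi, hδx, mul_comm]
        rw [Finset.sum_congr rfl e, Finset.sum_const, nsmul_eq_mul]
      calc Real.sqrt (sensitivityAt f x) = Real.sqrt s := by rw [← hScard]
        _ = 2 * (s * (a * b)) := by
            rw [hab, show 2 * (s * (1 / (2 * Real.sqrt s))) = s / Real.sqrt s by ring,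
              Real.div_sqrt]
        _ = ∑ p ∈ E₁ ∪ E₂, t p := by rw [Finset.sum_union hdisj, hE₁sum, hE₂sum]; ring
        _ ≤ ∑ p ∈ Finset.univ ×ˢ Finset.univ, t p :=
            Finset.sum_le_sum_of_subset_of_nonneg
              (by rw [Finset.univ_product_univ]; exact Finset.subset_univ _) fun p _ _ => ht0 p
        _ = ∑ y, ∑ i,
              (if f y = f (flipBlock y {i}) then (0 : ℝ) else δ y * δ (flipBlock y {i})) := by
            rw [Finset.sum_product]

/-- **ABKRT Lemma 32 `s(f) ≤ λ(f)²`, Rayleigh form**: some unit `δ ≥ 0` has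
`√(s(f)) ≤ ∑_y ∑_{i : f(y) ≠ f(y^i)} δ_y δ_{y^i}` (the star witness at an input of maximal
sensitivity). With `Sensitivity.lambdaSum_le_sensitivity_mul_sum_sq` this brackets every such
`λ`-sum certificate between `√s(f)` and `s(f)`; «tight for the `OR_n` function, `s(OR_n) = n` and
`λ(OR_n) = √n`». [cite: AaronsonBenDavidKothariRaoTal2021, Lemma 32] -/
theorem exists_unit_sqrt_sensitivity_le_lambdaSum (f : (Fin N → Bool) → Bool) :
    ∃ δ : (Fin N → Bool) → ℝ, (∀ y, 0 ≤ δ y) ∧ ∑ y, δ y ^ 2 = 1 ∧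
      Real.sqrt (sensitivity f) ≤
        ∑ y, ∑ i, (if f y = f (flipBlock y {i}) then (0 : ℝ) else δ y * δ (flipBlock y {i})) := by
  classical
  obtain ⟨x, -, hx⟩ := Finset.exists_mem_eq_sup (Finset.univ : Finset (Fin N → Bool))
    ⟨fun _ => false, Finset.mem_univ _⟩ (sensitivityAt f)
  obtain ⟨δ, hδ, hδ1, hle⟩ := exists_unit_sqrt_sensitivityAt_le_lambdaSum f x
  refine ⟨δ, hδ, hδ1, ?_⟩
  rw [sensitivity, hx]
  exact hle

end Literature.Computability.Complexity

end
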